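import Mathlib
import Literature.Combinatorics.Enumerative.DombNumbers
import Literature.Combinatorics.Enumerative.BinomialProductLucas
import HarnessLib

/-!
# Lucas congruences for the Domb numbers and for the moments `W₃(2k) = Σ_i C(k,i)² C(2i,i)`
(Adamczewski–Bell–Delaygue 2019, table of §8.3.1)

Topic `Literature/Combinatorics/Enumerative`.  Everything in this file is PROVED (no named facts).

## Source, as printed

[AdamczewskiBellDelaygue2019] B. Adamczewski, J. P. Bell, É. Delaygue, *Algebraic independence of
`G`-functions and congruences "à la Lucas"*, Ann. Sci. Éc. Norm. Supér. (4) **52** (2019) 515–559, §8.3.1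
(held text `paper:arxiv-1603.04187` pp. 29–30): «we gather in the following table some classical sequences for
which we prove that they satisfy the `p`-Lucas property for all primes `p`. Indeed, they all arise from
specialization in `(x,x)` of bivariate power series `F_{e,f}(x_1,x_2)` …», the table containing the rows
`Σ_k C(n,k)² C(2k,k)` — `(n_1+n_2)!²(2n_1)!/(n_1!⁴ n_2!²)` — «Number of abelian squares of length `2n` over an
alphabet with 3 letters (A002893)» and `Σ_k C(n,k)² C(2k,k) C(2(n−k),n−k)` —
`(n_1+n_2)!²(2n_1)!(2n_2)!/(n_1!⁴ n_2!⁴)` — «Domb numbers (A002895)».  (`p`-Lucas property, Def. 3.8: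
`a(v + mp) ≡ a(v) a(m) mod p` for `0 ≤ v < p`.)

## What is formalised (everything PROVED)

The tree's `threeStepMoment k = Σ_{i ≤ k} C(k,i)² C(2i,i)` (= A002893, `1, 3, 15, 93, 639, …`) and
`domb k = Σ_{j ≤ k} C(k,j)² threeStepMoment j` (the Domb numbers `1, 4, 28, 256, 2716, …` in the NESTED form of
`DombNumbers.lean`; the table's single-sum form is the classical equivalent expression) are specialisations
`Σ_{|𝐧| = k} Q(𝐧)` of binomial-type factorial ratios — in the variables `(i, k−i)`, resp. `(i, j−i, k−j)`:
`Q = C(n₁+n₂,n₁)² C(2n₁,n₁)`, resp. `Q = C(n₁+n₂+n₃, n₁+n₂)² C(n₁+n₂,n₁)² C(2n₁,n₁)` — whose carry hypotheses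
are immediate, so `BinomialProductLucas.spec_binomProd_modEq_mul / _prod_digits`
([AdamczewskiBellDelaygue2019, Props. 8.7, 7.4]) give:

* `threeStepMoment_eq_spec`, `domb_eq_spec` (the re-indexings);
* **`threeStepMoment_modEq_mul`**, **`threeStepMoment_modEq_prod_digits`** — `W₃(2(v+mp)) ≡ W₃(2v) W₃(2m)`
  and the product over base-`p` digits, every prime `p`;
* **`domb_modEq_mul`**, **`domb_modEq_prod_digits`** — the same for the Domb numbers.

Not covered: the other rows of the table (both Apéry sequences and `Σ C(n,k)^r C(n+k,k)^s` are
`AperyLucasCongruences.genApery_modEq_mul`; central binomials/Delannoy likewise), the single-sum form of the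
Domb numbers, supercongruences (Chan–Cooper–Sica, Osburn–Sahu).  Nearest existing declarations (used, not
restated): `Literature.Combinatorics.Enumerative.{threeStepMoment, domb}`, `BinomialProductLucas.*`.
-/

namespace Literature.Combinatorics.Enumerative.DombLucasCongruences

open Finset BinomialProductLucas

/-! ## The binomial data -/

/-- Bottom forms for `W₃(2k)`: `C(k,i)` (twice) and `C(2i,i)`, variables `(i, k−i)`.
[cite: AdamczewskiBellDelaygue2019, §8.3.1 (table, A002893)] -/
def u3 : Fin 3 → Fin 2 → ℕ := ![![1, 0], ![1, 0], ![1, 0]]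

/-- Co-bottom forms for `W₃(2k)`. [cite: AdamczewskiBellDelaygue2019, §8.3.1 (table, A002893)] -/
def w3 : Fin 3 → Fin 2 → ℕ := ![![0, 1], ![0, 1], ![1, 0]]

/-- Bottom forms for the Domb numbers (nested form): `C(k,j)` (twice), `C(j,i)` (twice), `C(2i,i)`, variables
`(i, j−i, k−j)`. [cite: AdamczewskiBellDelaygue2019, §8.3.1 (table, A002895)] -/
def uD : Fin 5 → Fin 3 → ℕ := ![![1, 1, 0], ![1, 1, 0], ![1, 0, 0], ![1, 0, 0], ![1, 0, 0]]

/-- Co-bottom forms for the Domb numbers. [cite: AdamczewskiBellDelaygue2019, §8.3.1 (table, A002895)] -/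
def wD : Fin 5 → Fin 3 → ℕ := ![![0, 0, 1], ![0, 0, 1], ![0, 1, 0], ![0, 1, 0], ![1, 0, 0]]

/-- `Q(n₁,n₂) = C(n₁+n₂,n₁)² C(2n₁,n₁)`. [cite: AdamczewskiBellDelaygue2019, §8.3.1] -/
theorem binomProd_u3 (x : Fin 2 → ℕ) :
    binomProd u3 w3 x = (x 0 + x 1).choose (x 0) ^ 2 * (x 0 + x 0).choose (x 0) := by
  simp only [binomProd, dot, u3, w3, Fin.prod_univ_three, Fin.sum_univ_two, Matrix.cons_val_zero,
    Matrix.cons_val_one, Matrix.cons_val, one_mul, zero_mul, add_zero, zero_add]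
  ring

/-- `Q(n₁,n₂,n₃) = C(n₁+n₂+n₃,n₁+n₂)² C(n₁+n₂,n₁)² C(2n₁,n₁)`. [cite: AdamczewskiBellDelaygue2019, §8.3.1] -/
theorem binomProd_uD (x : Fin 3 → ℕ) :
    binomProd uD wD x
      = (x 0 + x 1 + x 2).choose (x 0 + x 1) ^ 2 * (x 0 + x 1).choose (x 0) ^ 2 * (x 0 + x 0).choose (x 0) := by
  simp only [binomProd, dot, uD, wD, Fin.prod_univ_five, Fin.sum_univ_three, Matrix.cons_val_zero,
    Matrix.cons_val_one, Matrix.cons_val, one_mul, zero_mul, add_zero, zero_add]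
  ring

/-! ## Re-indexing: the tree's sums are the specialisations `Σ_{|𝐧|=k} Q(𝐧)` -/

/-- `W₃(2k) = Σ_{|𝐧| = k} Q(𝐧)` (`𝐛 = (1,1)`). [cite: AdamczewskiBellDelaygue2019, §8.3.1 (specialisation in (x,x))] -/
theorem threeStepMoment_eq_spec (k : ℕ) : (threeStepMoment k : ℤ) = spec ![1, 1] (binomProd u3 w3) k := by
  unfold spec threeStepMoment
  push_cast
  refine sum_nbij' (fun i => ![i, k - i]) (fun x => x 0) ?_ ?_ ?_ ?_ ?_
  · intro i hi
    rw [mem_range] at hi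
    rw [Finset.Nat.mem_antidiagonalTuple, Fin.sum_univ_two]
    simp only [Matrix.cons_val_zero, Matrix.cons_val_one]
    omega
  · intro x hx
    rw [Finset.Nat.mem_antidiagonalTuple, Fin.sum_univ_two] at hx
    rw [mem_range]
    omega
  · intro i _
    simp
  · intro x hx
    rw [Finset.Nat.mem_antidiagonalTuple, Fin.sum_univ_two] at hx
    funext i
    refine Fin.cases ?_ (fun j => ?_) i
    · simp
    · have hj : j = 0 := Subsingleton.elim _ _
      subst hj
      simp only [Fin.succ_zero_eq_one, Matrix.cons_val_one, Matrix.cons_val_zero]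
      omega
  · intro i hi
    rw [mem_range] at hi
    rw [binomProd_u3]
    simp only [Fin.prod_univ_two, Matrix.cons_val_zero, Matrix.cons_val_one, one_pow, one_mul]
    have e : i + (k - i) = k := by omega
    rw [e, ← two_mul]
    push_cast
    ring

/-- `D_k = Σ_{|𝐧| = k} Q(𝐧)` (`𝐛 = (1,1,1)`), the Domb numbers in the nested form of `DombNumbers.domb`.
[cite: AdamczewskiBellDelaygue2019, §8.3.1 (specialisation in (x,x))] -/
theorem domb_eq_spec (k : ℕ) : (domb k : ℤ) = spec ![1, 1, 1] (binomProd uD wD) k := by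
  unfold spec domb threeStepMoment
  push_cast
  simp_rw [Finset.mul_sum]
  rw [Finset.sum_sigma']
  refine sum_nbij' (fun ji => ![ji.2, ji.1 - ji.2, k - ji.1]) (fun x => ⟨x 0 + x 1, x 0⟩) ?_ ?_ ?_ ?_ ?_
  · rintro ⟨j, i⟩ h
    simp only [mem_sigma, mem_range] at h
    rw [Finset.Nat.mem_antidiagonalTuple, Fin.sum_univ_three]
    simp only [Matrix.cons_val_zero, Matrix.cons_val_one, Matrix.cons_val_two, Matrix.tail_cons,
      Matrix.head_cons]
    omega
  · intro x hx
    rw [Finset.Nat.mem_antidiagonalTuple, Fin.sum_univ_three] at hx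
    simp only [mem_sigma, mem_range]
    omega
  · rintro ⟨j, i⟩ h
    simp only [mem_sigma, mem_range] at h
    simp only [Matrix.cons_val_zero, Matrix.cons_val_one, Sigma.mk.injEq, heq_eq_eq, and_true]
    omega
  · intro x hx
    rw [Finset.Nat.mem_antidiagonalTuple, Fin.sum_univ_three] at hx
    funext i
    refine Fin.cases ?_ (fun j => ?_) i
    · simp
    · refine Fin.cases ?_ (fun l => ?_) j
      · simp only [Fin.succ_zero_eq_one, Matrix.cons_val_one, Matrix.cons_val_zero]
        omega
      · have hl : l = 0 := Subsingleton.elim _ _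
        subst hl
        simp only [Fin.succ_zero_eq_one, Fin.succ_one_eq_two, Matrix.cons_val_two, Matrix.tail_cons,
          Matrix.head_cons]
        omega
  · rintro ⟨j, i⟩ h
    simp only [mem_sigma, mem_range] at h
    rw [binomProd_uD]
    simp only [Fin.prod_univ_three, Matrix.cons_val_zero, Matrix.cons_val_one, Matrix.cons_val_two,
      Matrix.head_cons, Matrix.tail_cons, one_pow, one_mul]
    have e1 : i + (j - i) = j := by omega
    have e2 : i + (j - i) + (k - j) = k := by omega
    rw [e2, e1, ← two_mul]
    push_cast
    ring

/-! ## Carry hypotheses (immediate) -/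

/-- For `W₃(2k)`: with digits `v₀, v₁ < p`, a top form `≥ p` (`v₀+v₁` or `2v₀`) IS a units-digit carry.
[cite: AdamczewskiBellDelaygue2019, Cor. 8.8, Prop. 7.4] -/
theorem carryHyp3 (p : ℕ) : CarryHyp u3 w3 p ∧ SumCarryHyp u3 w3 p := by
  refine ⟨fun v hv htop => ?_, fun v hv hsum => ?_⟩
  · have e0 : v 0 % p = v 0 := Nat.mod_eq_of_lt (hv 0)
    have e1 : v 1 % p = v 1 := Nat.mod_eq_of_lt (hv 1)
    simp only [Fin.exists_fin_succ, IsEmpty.exists_iff, or_false, dot, u3, w3, Fin.sum_univ_two,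
      Matrix.cons_val_zero, Matrix.cons_val_succ, Matrix.cons_val_one, one_mul, zero_mul, add_zero,
      zero_add] at htop ⊢
    omega
  · have e0 : v 0 % p = v 0 := Nat.mod_eq_of_lt (hv 0)
    have e1 : v 1 % p = v 1 := Nat.mod_eq_of_lt (hv 1)
    rw [Fin.sum_univ_two] at hsum
    refine ⟨0, ?_⟩
    simp only [dot, u3, w3, Fin.sum_univ_two, Matrix.cons_val_zero, Matrix.cons_val_one, one_mul, zero_mul,
      add_zero, zero_add]
    omega

/-- For the Domb data: with digits `vᵢ < p`, no carry anywhere forces `2v₀ < p`, `v₀+v₁ < p`, `v₀+v₁+v₂ < p`, so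
every top form is `< p`. [cite: AdamczewskiBellDelaygue2019, Cor. 8.8, Prop. 7.4] -/
theorem carryHypD (p : ℕ) : CarryHyp uD wD p ∧ SumCarryHyp uD wD p := by
  have key : ∀ v : Fin 3 → ℕ, (∀ i, v i < p) → (∀ j, dot (uD j) v % p + dot (wD j) v % p < p) →
      v 0 + v 0 < p ∧ v 0 + v 1 < p ∧ v 0 + v 1 + v 2 < p := by
    intro v hv h
    have h0 := h 0
    have h2 := h 2
    have h4 := h 4
    simp only [dot, uD, wD, Fin.sum_univ_three, Matrix.cons_val_zero, Matrix.cons_val_one, Matrix.cons_val,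
      one_mul, zero_mul, add_zero, zero_add] at h0 h2 h4
    have e0 : v 0 % p = v 0 := Nat.mod_eq_of_lt (hv 0)
    have e1 : v 1 % p = v 1 := Nat.mod_eq_of_lt (hv 1)
    have e2 : v 2 % p = v 2 := Nat.mod_eq_of_lt (hv 2)
    have f1 : v 0 + v 1 < p := by omega
    have e01 : (v 0 + v 1) % p = v 0 + v 1 := Nat.mod_eq_of_lt f1
    refine ⟨by omega, f1, by omega⟩
  refine ⟨fun v hv htop => ?_, fun v hv hsum => ?_⟩
  · by_contra hno
    push Not at hno
    obtain ⟨hA, hB, hC⟩ := key v hv hno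
    simp only [Fin.exists_fin_succ, IsEmpty.exists_iff, or_false, dot, uD, wD, Fin.sum_univ_three,
      Matrix.cons_val_zero, Matrix.cons_val_succ, Matrix.cons_val_one, Matrix.cons_val, one_mul, zero_mul,
      add_zero, zero_add] at htop
    omega
  · by_contra hno
    push Not at hno
    obtain ⟨-, -, hC⟩ := key v hv hno
    rw [Fin.sum_univ_three] at hsum
    omega

/-! ## The Lucas congruences -/

section Lucas

variable {p : ℕ} [hp : Fact p.Prime]

/-- **`W₃(2k) = Σ_i C(k,i)² C(2i,i)` (A002893) has the `p`-Lucas property for every prime `p`**: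
`W₃(2(v + pm)) ≡ W₃(2v) · W₃(2m) (mod p)` for `0 ≤ v < p`. [cite: AdamczewskiBellDelaygue2019, §8.3.1 (table)] -/
theorem threeStepMoment_modEq_mul (v m : ℕ) (hv : v < p) :
    threeStepMoment (v + p * m) ≡ threeStepMoment v * threeStepMoment m [MOD p] := by
  have h := spec_binomProd_modEq_mul u3 w3 ![1, 1] (carryHyp3 p).1 (carryHyp3 p).2 v m hv
  rw [← threeStepMoment_eq_spec, ← threeStepMoment_eq_spec, ← threeStepMoment_eq_spec] at h
  exact_mod_cast (Int.natCast_modEq_iff).mp (by exact_mod_cast h)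

/-- **Lucas congruence for `W₃(2k)`, all digits.** [cite: AdamczewskiBellDelaygue2019, §8.3.1 (table)] -/
theorem threeStepMoment_modEq_prod_digits (n : ℕ) :
    threeStepMoment n ≡ ((Nat.digits p n).map threeStepMoment).prod [MOD p] := by
  have h := spec_binomProd_modEq_prod_digits u3 w3 ![1, 1] (carryHyp3 p).1 (carryHyp3 p).2 n
  have e : spec ![1, 1] (binomProd u3 w3) = fun k => (threeStepMoment k : ℤ) :=
    funext fun k => (threeStepMoment_eq_spec k).symm
  rw [e] at h
  refine (Int.natCast_modEq_iff).mp ?_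
  have e' : (((Nat.digits p n).map threeStepMoment).prod : ℤ)
      = ((Nat.digits p n).map fun k => (threeStepMoment k : ℤ)).prod := by
    rw [Nat.cast_list_prod, List.map_map]
    rfl
  rw [e']
  exact h

/-- **The Domb numbers have the `p`-Lucas property for every prime `p`**:
`D_{v + pm} ≡ D_v · D_m (mod p)` for `0 ≤ v < p`. [cite: AdamczewskiBellDelaygue2019, §8.3.1 (table, Domb numbers)] -/
theorem domb_modEq_mul (v m : ℕ) (hv : v < p) : domb (v + p * m) ≡ domb v * domb m [MOD p] := by
  have h := spec_binomProd_modEq_mul uD wD ![1, 1, 1] (carryHypD p).1 (carryHypD p).2 v m hv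
  rw [← domb_eq_spec, ← domb_eq_spec, ← domb_eq_spec] at h
  exact_mod_cast (Int.natCast_modEq_iff).mp (by exact_mod_cast h)

/-- **Lucas congruence for the Domb numbers, all digits**: `D_n ≡ ∏_i D_{n_i} (mod p)` over the base-`p`
digits of `n`. [cite: AdamczewskiBellDelaygue2019, §8.3.1 (table, Domb numbers)] -/
theorem domb_modEq_prod_digits (n : ℕ) : domb n ≡ ((Nat.digits p n).map domb).prod [MOD p] := by
  have h := spec_binomProd_modEq_prod_digits uD wD ![1, 1, 1] (carryHypD p).1 (carryHypD p).2 n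
  have e : spec ![1, 1, 1] (binomProd uD wD) = fun k => (domb k : ℤ) := funext fun k => (domb_eq_spec k).symm
  rw [e] at h
  refine (Int.natCast_modEq_iff).mp ?_
  have e' : (((Nat.digits p n).map domb).prod : ℤ) = ((Nat.digits p n).map fun k => (domb k : ℤ)).prod := by
    rw [Nat.cast_list_prod, List.map_map]
    rfl
  rw [e']
  exact h

end Lucas

end Literature.Combinatorics.Enumerative.DombLucasCongruences
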